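import Literature.Probability.RandomPlanarGeometry.SAWCountMonotoneUpToFourD
import HarnessLib

/-!
# Monotonicity `cₙ ≤ cₙ₊₁` (O'Brien 1990) for every EVEN `n ≤ 8d - 8`: no doubly trapped walk of even
# length below `8d - 6`

Sequel of `SAWCountMonotoneUpToFourD.lean` (`T₂ = doublyTrapped d n = ∅` for `n ≤ 4d`, hence
`cₙ ≤ cₙ₊₁` for `n ≤ 4d` by the reversal pairing `cₙ ≤ cₙ₊₁ + #T₂` of `SAWCountMonotoneReversal.lean`).
For EVEN `n` the same two ingredients — bipartiteness of `ℤ^d` and "two distinct sites have at most two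
common neighbours" (`eq_or_eq_of_adj_adj`) — go twice as far, by pure counting:

if the end `e = ω n` of an `n`-step self-avoiding walk is trapped, its `2d` neighbours are visited, at
ODD times `< n` (parity); if moreover the start has at most one free neighbour, at least `2d - 1`
neighbours of `0` are visited, again at odd times `< n` (parity, and `n` itself is even). These two
sets of sites share at most the two common neighbours of `0` and `e`, so at least `4d - 3` distinct
sites are visited at the `n/2` odd times below `n`: **`8d - 6 ≤ n`**.

* `card_filter_range_odd_le` : there are at most `n / 2` odd times below `n`;
* `doublyTrapped_eq_empty_of_even` : **`T₂ = ∅` for every even `n ≤ 8d - 8`** (all `d`);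
* `count_le_count_succ_of_even` : **`cₙ ≤ cₙ₊₁` for every even `n ≤ 8d - 8`, in every dimension**
  (`d = 3`: the even lengths `14, 16` beyond the range `n ≤ 12` of the `4d` file).

The threshold is sharp in `d = 2`: the `10`-step walk `0, e₁, e₁+e₂, e₂, 2e₂, 2e₂-e₁, 2e₂-2e₁, e₂-2e₁,
-2e₁, -e₁, e₂-e₁` is doubly trapped (its end `e₂-e₁` is enclosed and its start keeps the single free
neighbour `-e₂`), and `8d - 6 = 10`; exact enumeration (lane «pcv-sawmu», not used in any proof) gives
`#T₂ = 8` at `n = 10` on `ℤ²`. The odd lengths are treated in the sibling file on odd `n`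
(threshold `6d - 3`).

[cite: MadrasSlade1993, §1.2 (p. 10: sites at times of different parity are distinct); §7.1]
[cite: BDGS2012, §1.3 (`cₙ ≤ cₙ₊₁`, O'Brien 1990)]
-/

noncomputable section

open Literature.Probability.LatticeModels Literature.Probability.Percolation SimpleGraph
open scoped BigOperators

namespace Literature.Probability.RandomPlanarGeometry.SAW.Zd

variable {d : ℕ}

/-! ### Counting odd times -/

/-- There are at most `n / 2` odd natural numbers below `n` (the times of one parity used in the parity count of
Madras–Slade §1.2). [cite: MadrasSlade1993, §1.2, p. 10] -/
theorem card_filter_range_odd_le (n : ℕ) :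
    ((Finset.range n).filter fun i => i % 2 = 1).card ≤ n / 2 := by
  have hmaps : ∀ i ∈ (Finset.range n).filter (fun i => i % 2 = 1), i / 2 ∈ Finset.range (n / 2) := by
    intro i hi
    rw [Finset.mem_filter, Finset.mem_range] at hi
    rw [Finset.mem_range]; omega
  have hinj : Set.InjOn (fun i => i / 2) ((Finset.range n).filter fun i => i % 2 = 1 : Set ℕ) := by
    intro i hi i' hi' h
    rw [Finset.mem_coe, Finset.mem_filter] at hi hi'
    simp only at h; omega
  have := Finset.card_le_card_of_injOn (fun i => i / 2) hmaps hinj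
  rwa [Finset.card_range] at this

/-! ### Common neighbours, as a cardinality bound -/

/-- Two distinct sites of `ℤ^d` have at most two common neighbours inside any finite set of sites
(`eq_or_eq_of_adj_adj`: they are `z` and `x + y - z`). [cite: MadrasSlade1993, §1.1] -/
theorem card_filter_adj_adj_le_two {x y : Site d} (hxy : x ≠ y) (s : Finset (Site d)) :
    (s.filter fun z => (zdGraph d).Adj x z ∧ (zdGraph d).Adj z y).card ≤ 2 := by
  classical
  set C := s.filter fun z => (zdGraph d).Adj x z ∧ (zdGraph d).Adj z y with hC
  rcases Nat.eq_zero_or_pos C.card with h | h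
  · omega
  obtain ⟨z₀, hz₀⟩ := Finset.card_pos.1 h
  have hsub : C ⊆ {z₀, x + y - z₀} := by
    intro z hz
    obtain ⟨-, ha, hb⟩ := Finset.mem_filter.1 hz₀
    obtain ⟨-, ha', hb'⟩ := Finset.mem_filter.1 hz
    rcases eq_or_eq_of_adj_adj hxy ha hb ha' hb' with e | e
    · rw [e]; exact Finset.mem_insert_self _ _
    · rw [e]; exact Finset.mem_insert_of_mem (Finset.mem_singleton_self _)
  exact (Finset.card_le_card hsub).trans
    ((Finset.card_insert_le _ _).trans (by rw [Finset.card_singleton]))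

/-! ### No doubly trapped walk of even length below `8d - 6` -/

/-- **No doubly trapped walk of even length `n ≤ 8d - 8`.** If `n` is even and the end
`e = ω n` of an `n`-step self-avoiding walk `ω` is trapped while its start has at most one free
neighbour, then the `2d` neighbours of `e` and at least `2d - 1` neighbours of `0` are visited, all at
odd times `< n` (`ℤ^d` is bipartite and `n` is even); they overlap in at most the two common neighbours
of `0 ≠ e`, so `4d - 3 ≤ n/2`, i.e. `8d - 6 ≤ n`. [cite: MadrasSlade1993, §1.2, p. 10; §7.1]
[cite: BDGS2012, §1.3] -/
theorem doublyTrapped_eq_empty_of_even {n : ℕ} (hev : Even n) (hn : n + 7 ≤ 8 * d) :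
    doublyTrapped d n = ∅ := by
  classical
  refine Finset.eq_empty_of_forall_notMem fun ω hωT => ?_
  obtain ⟨hω, h0, h1⟩ := mem_doublyTrapped.1 hωT
  obtain ⟨h00, -, -, hinj⟩ := mem_saws.1 hω
  have hn2 : n % 2 = 0 := Nat.even_iff.1 hev
  have hn7 : 4 * d ≤ n + 1 := four_mul_le_of_extCount_eq_zero hω h0
  have hinj' : ∀ i ≤ n, ∀ j ≤ n, ω i = ω j → i = j := fun i hi j hj h =>
    hinj (show i ∈ {i | i ≤ n} from hi) (show j ∈ {i | i ≤ n} from hj) h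
  have h0n : ω n ≠ ω 0 := fun h => by have := hinj' n le_rfl 0 (Nat.zero_le n) h; omega
  -- the sites visited at odd times below `n`
  set O := (Finset.range n).filter fun i => i % 2 = 1 with hO
  set V := O.image ω with hV
  have hVcard : V.card ≤ n / 2 := Finset.card_image_le.trans (card_filter_range_odd_le n)
  -- `A`: the neighbours of the trapped end, all visited at odd times `< n`
  set A := nbrs (ω n) with hA
  have hAV : A ⊆ V := by
    intro y hy
    have hadj := mem_nbrs.1 hy
    have hvis : ∃ i ≤ n, ω i = y := by
      by_contra h
      have : y ∈ freeNbrs ω n := mem_freeNbrs.2 ⟨hadj, fun i hi hiy => h ⟨i, hi, hiy⟩⟩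
      rw [extCount, Finset.card_eq_zero] at h0
      rw [h0] at this
      exact Finset.notMem_empty y this
    obtain ⟨i, hi, rfl⟩ := hvis
    have hin : i ≠ n := fun h => hadj.ne (by rw [h])
    have hpar := odd_add_of_adj_apply hω hi hadj
    refine Finset.mem_image.2 ⟨i, ?_, rfl⟩
    rw [hO, Finset.mem_filter, Finset.mem_range]
    exact ⟨by omega, by omega⟩
  -- `W`: the visited neighbours of the start, at least `2d - 1` of them, visited at odd times `< n`
  set U := (nbrs (ω 0)).filter fun z => ∀ i ≤ n, ω i ≠ z with hU
  set W := (nbrs (ω 0)).filter fun z => ¬ ∀ i ≤ n, ω i ≠ z with hW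
  have hUW : U.card + W.card = 2 * d := by
    rw [hU, hW, Finset.card_filter_add_card_filter_not, card_nbrs]
  have hU1 : U.card ≤ 1 := (card_filter_nbrs_start_le_extCount_revWalk hω).trans h1
  have hWV : W ⊆ V := by
    intro z hz
    rw [hW, Finset.mem_filter] at hz
    obtain ⟨hz, hvis⟩ := hz
    have hadj0 := mem_nbrs.1 hz
    have hex : ∃ i ≤ n, ω i = z := by
      by_contra h; exact hvis fun i hi hiz => h ⟨i, hi, hiz⟩
    obtain ⟨j, hj, rfl⟩ := hex
    have hpar := odd_add_of_adj_apply_apply hω (Nat.zero_le n) hj hadj0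
    refine Finset.mem_image.2 ⟨j, ?_, rfl⟩
    rw [hO, Finset.mem_filter, Finset.mem_range]
    exact ⟨by omega, by omega⟩
  -- the overlap: common neighbours of `ω n` and `ω 0`
  have hAW : (A ∩ W).card ≤ 2 := by
    have hsub : A ∩ W ⊆ (nbrs (ω n)).filter fun z => (zdGraph d).Adj (ω n) z ∧ (zdGraph d).Adj z (ω 0) := by
      intro z hz
      rw [Finset.mem_inter] at hz
      obtain ⟨hzA, hzW⟩ := hz
      rw [hW, Finset.mem_filter] at hzW
      exact Finset.mem_filter.2 ⟨hzA, mem_nbrs.1 hzA, (mem_nbrs.1 hzW.1).symm⟩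
    exact (Finset.card_le_card hsub).trans (card_filter_adj_adj_le_two h0n _)
  -- count
  have hunion : (A ∪ W).card ≤ V.card := Finset.card_le_card (Finset.union_subset hAV hWV)
  have hAcard : A.card = 2 * d := card_nbrs _
  have hIE := Finset.card_union_add_card_inter A W
  omega

/-- **`cₙ ≤ cₙ₊₁` for every even `n ≤ 8d - 8`, in every dimension**: by the reversal pairing
`count_le_count_succ_add_card_doublyTrapped` (`cₙ ≤ cₙ₊₁ + #T₂`) and `doublyTrapped_eq_empty_of_even`.
(`d = 2`: even `n ≤ 8`; `d = 3`: even `n ≤ 16`, i.e. the lengths `14, 16` beyond the `4d` file; the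
general inequality is O'Brien's theorem, the tree's named fact `BDGS2012_count_mono`.)
[cite: BDGS2012, §1.3] [cite: MadrasSlade1993, §7.1] -/
theorem count_le_count_succ_of_even {n : ℕ} (hev : Even n) (hn : n + 7 ≤ 8 * d) :
    count d n ≤ count d (n + 1) := by
  have := count_le_count_succ_add_card_doublyTrapped d n
  rw [doublyTrapped_eq_empty_of_even hev hn, Finset.card_empty, add_zero] at this
  exact this

end Literature.Probability.RandomPlanarGeometry.SAW.Zd
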